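import Mathlib.Analysis.SpecialFunctions.Integrals.Basic
import Literature.NumberTheory.LFunctions.ExplicitFormulaPsi
import HarnessLib

/-!
# Twisted prime sums under GRH, II: the remainder of the explicit formula, integrated

Topic `Literature/NumberTheory/LFunctions`. THEOREMS (everything proved). Second support file of
the GRH bound for the twisted Chebyshev function `ψ(x, χ, t) = ∑_{n ≤ x} χ(n) Λ(n) n^{-it}`
(`GRHTwistedCharacterPrimeSums.lean`). Abel summation turns the remainder `R(u, T)` of the
truncated explicit formula for `ψ(u, χ)` (Montgomery–Vaughan Thm. 12.10, (12.8):
`R ≪ (log u) min(1, u/(T⟨u⟩)) + (u/T) log²(quT)`, `⟨u⟩` the distance from `u` to the nearest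
prime power other than `u`) into the integral `it ∫_c^X R(u, T) u^{-it-1} du`, which must be
`O(log X)` although it carries the factor `|t|`: this holds for `T ≥ x²(|t| + 2)²` because the
set where `min(1, u/(T⟨u⟩))` is not tiny has small measure. We prove it in the form

* `min_one_div_le_sqrt_mul` — `min(1, u/(T⟨u⟩)) ≤ (u/T)^{1/2} φ(u)` for `u ≥ 1`, where
  `φ(u) = (u − ⌊u⌋)^{-1/2} + (⌊u⌋ + 1 − u)^{-1/2}` (for non-integral `u` every prime power is an
  integer at distance `≥ min(u − ⌊u⌋, ⌊u⌋ + 1 − u)` from `u`, `min_sub_floor_le_primePowDist`;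
  at an integer `⟨u⟩ ≥ 1`);
* `intervalIntegrable_phi`, `integral_phi` — `∫_a^{a+N} φ = 4N` over unit intervals;
* `norm_integral_remainder_le` — the packaged bound: if `‖G(u)‖ ≤ |t| u⁻¹ K R⋆(u, T)` a.e. on
  `(c, X]` with `R⋆` the majorant of (12.8), then
  `‖∫_c^X G‖ ≤ |t| K (4 X log X/(cT)^{1/2} + X log²(qXT)/T)`.

## References

* H. L. Montgomery, R. C. Vaughan, *Multiplicative Number Theory I. Classical Theory*, CUP 2007,
  Theorem 12.10 (12.8). [MontgomeryVaughan2007]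
-/

noncomputable section

open Real MeasureTheory Set intervalIntegral

namespace Literature.NumberTheory.LFunctions

namespace GRHTwistedPrimeSum

/-! ### `⟨u⟩` and the distance to the nearest integer -/

/-- `min(1, z) ≤ √z` for `z ≥ 0`. [folklore] -/
theorem min_one_le_sqrt {z : ℝ} (hz : 0 ≤ z) : min 1 z ≤ Real.sqrt z := by
  rcases le_or_gt z 1 with h | h
  · refine (min_le_right _ _).trans ?_
    rw [Real.le_sqrt hz hz]
    nlinarith
  · exact (min_le_left _ _).trans (Real.one_le_sqrt.2 h.le)

/-- Every prime power is an integer, so `⟨u⟩ ≥ min(u − ⌊u⌋, ⌊u⌋ + 1 − u)` for `u ≥ 0`.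
[folklore] -/
theorem min_sub_floor_le_primePowDist {u : ℝ} (hu : 0 ≤ u) :
    min (u - ⌊u⌋₊) (⌊u⌋₊ + 1 - u) ≤ primePowDist u := by
  refine le_ciInf fun m ↦ ?_
  obtain ⟨m, -, -⟩ := m
  dsimp only
  have hfl : (⌊u⌋₊ : ℝ) ≤ u := Nat.floor_le hu
  have hlt : u < ⌊u⌋₊ + 1 := Nat.lt_floor_add_one u
  rcases le_or_gt m ⌊u⌋₊ with h | h
  · have : (m : ℝ) ≤ ⌊u⌋₊ := by exact_mod_cast h
    rw [abs_of_nonneg (by linarith)]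
    exact (min_le_left _ _).trans (by linarith)
  · have : (⌊u⌋₊ : ℝ) + 1 ≤ m := by exact_mod_cast h
    rw [abs_of_nonpos (by linarith)]
    exact (min_le_right _ _).trans (by linarith)

/-- At an integer, the nearest *other* prime power is at distance `≥ 1`. [folklore] -/
theorem one_le_primePowDist_natCast (n : ℕ) : 1 ≤ primePowDist (n : ℝ) := by
  refine le_ciInf fun m ↦ ?_
  obtain ⟨m, -, hmu⟩ := m
  dsimp only
  have hne : m ≠ n := fun h ↦ hmu (by rw [h])
  rcases Nat.lt_or_gt_of_ne hne with h | h
  · have : (m : ℝ) + 1 ≤ n := by exact_mod_cast h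
    rw [abs_of_nonneg (by linarith)]; linarith
  · have : (n : ℝ) + 1 ≤ m := by exact_mod_cast h
    rw [abs_of_nonpos (by linarith)]; linarith

/-- **The pointwise majorant.** For `u ≥ 1` and `T > 0`,
`min(1, u/(T⟨u⟩)) ≤ (u/T)^{1/2} ((u − ⌊u⌋)^{-1/2} + (⌊u⌋ + 1 − u)^{-1/2})`
(`min(1, z) ≤ z^{1/2}` with `⟨u⟩ ≥` the distance to the nearest integer; at an integer `u` the
right side is `(u/T)^{1/2} · 1` since `0^{-1/2} = 0` in Mathlib, and `⟨u⟩ ≥ 1`). [folklore] -/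
theorem min_one_div_le_sqrt_mul {u T : ℝ} (hu : 1 ≤ u) (hT : 0 < T) :
    min 1 (u / (T * primePowDist u)) ≤
      Real.sqrt (u / T) * ((u - ⌊u⌋₊) ^ (-(1 / 2 : ℝ)) + (⌊u⌋₊ + 1 - u) ^ (-(1 / 2 : ℝ))) := by
  have hu0 : 0 ≤ u := by linarith
  have hfl : (⌊u⌋₊ : ℝ) ≤ u := Nat.floor_le hu0
  have hlt : u < ⌊u⌋₊ + 1 := Nat.lt_floor_add_one u
  have ha0 : 0 ≤ u - ⌊u⌋₊ := sub_nonneg.2 hfl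
  have hb0 : 0 < ⌊u⌋₊ + 1 - u := by linarith
  have hφa : 0 ≤ (u - ⌊u⌋₊) ^ (-(1 / 2 : ℝ)) := Real.rpow_nonneg ha0 _
  have hφb : 0 ≤ ((⌊u⌋₊ : ℝ) + 1 - u) ^ (-(1 / 2 : ℝ)) := Real.rpow_nonneg hb0.le _
  rcases ha0.eq_or_lt with ha | ha
  · -- `u` is an integer
    have hun : ((⌊u⌋₊ : ℕ) : ℝ) = u := by linarith
    have h1 : 1 ≤ primePowDist u := by rw [← hun]; exact one_le_primePowDist_natCast _
    have hφ : 1 ≤ (u - ⌊u⌋₊) ^ (-(1 / 2 : ℝ)) + (⌊u⌋₊ + 1 - u) ^ (-(1 / 2 : ℝ)) := by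
      rw [← ha, Real.zero_rpow (by norm_num), zero_add, show (⌊u⌋₊ : ℝ) + 1 - u = 1 by linarith,
        Real.one_rpow]
    calc min 1 (u / (T * primePowDist u)) ≤ min 1 (u / T) := by
          refine min_le_min le_rfl (div_le_div_of_nonneg_left hu0 hT ?_)
          calc T = T * 1 := (mul_one T).symm
            _ ≤ T * primePowDist u := mul_le_mul_of_nonneg_left h1 hT.le
      _ ≤ Real.sqrt (u / T) := min_one_le_sqrt (by positivity)
      _ ≤ _ := le_mul_of_one_le_right (Real.sqrt_nonneg _) hφ
  · -- `u` is not an integer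
    obtain ⟨d, hd⟩ : ∃ d : ℝ, min (u - ⌊u⌋₊) (⌊u⌋₊ + 1 - u) = d := ⟨_, rfl⟩
    have hd0 : 0 < d := by rw [← hd]; exact lt_min ha hb0
    have hdle : d ≤ primePowDist u := hd ▸ min_sub_floor_le_primePowDist hu0
    have hφ : d ^ (-(1 / 2 : ℝ)) ≤ (u - ⌊u⌋₊) ^ (-(1 / 2 : ℝ)) + (⌊u⌋₊ + 1 - u) ^ (-(1 / 2 : ℝ)) := by
      rcases min_choice (u - ⌊u⌋₊) (⌊u⌋₊ + 1 - u) with h | h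
      · rw [← hd, h]; linarith
      · rw [← hd, h]; linarith
    have hsqrt : Real.sqrt (u / (T * d)) = Real.sqrt (u / T) * d ^ (-(1 / 2 : ℝ)) := by
      rw [div_mul_eq_div_div, Real.sqrt_div' _ hd0.le, Real.rpow_neg hd0.le, Real.sqrt_eq_rpow d,
        div_eq_mul_inv]
    calc min 1 (u / (T * primePowDist u)) ≤ min 1 (u / (T * d)) := by
          refine min_le_min le_rfl ?_
          exact div_le_div_of_nonneg_left hu0 (by positivity) (mul_le_mul_of_nonneg_left hdle hT.le)
      _ ≤ Real.sqrt (u / (T * d)) := min_one_le_sqrt (by positivity)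
      _ = Real.sqrt (u / T) * d ^ (-(1 / 2 : ℝ)) := hsqrt
      _ ≤ _ := mul_le_mul_of_nonneg_left hφ (Real.sqrt_nonneg _)

/-! ### The integral of `φ` over unit intervals -/

/-- On `[n, n + 1]`, `φ(u) = (u − n)^{-1/2} + (n + 1 − u)^{-1/2}` (also at the right endpoint,
where both sides equal `1`). [folklore] -/
theorem phi_eqOn (n : ℕ) :
    EqOn (fun u : ℝ ↦ (u - ⌊u⌋₊) ^ (-(1 / 2 : ℝ)) + (⌊u⌋₊ + 1 - u) ^ (-(1 / 2 : ℝ)))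
      (fun u : ℝ ↦ (u - n) ^ (-(1 / 2 : ℝ)) + ((n : ℝ) + 1 - u) ^ (-(1 / 2 : ℝ)))
      (uIcc (n : ℝ) (n + 1)) := by
  intro u hu
  rw [uIcc_of_le (by linarith)] at hu
  dsimp only
  rcases hu.2.eq_or_lt with h | h
  · rw [h, show (n : ℝ) + 1 = ((n + 1 : ℕ) : ℝ) by push_cast; ring, Nat.floor_natCast]
    push_cast
    rw [sub_self, show (n : ℝ) + 1 - n = 1 by ring, show (n : ℝ) + 1 + 1 - (n + 1) = 1 by ring,
      Real.zero_rpow (by norm_num), Real.one_rpow, zero_add, add_zero]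
  · have hfl : ⌊u⌋₊ = n := (Nat.floor_eq_iff (n.cast_nonneg.trans hu.1)).2 ⟨hu.1, h⟩
    rw [hfl]

/-- `φ` is integrable on `[n, n + 1]` and `∫_n^{n+1} φ = 4` (`∫_0^1 s^{-1/2} ds = 2`, twice).
[folklore] -/
theorem integral_phi_unit (n : ℕ) :
    IntervalIntegrable
        (fun u : ℝ ↦ (u - ⌊u⌋₊) ^ (-(1 / 2 : ℝ)) + (⌊u⌋₊ + 1 - u) ^ (-(1 / 2 : ℝ))) volume n (n + 1) ∧
      ∫ u in (n : ℝ)..(n + 1), ((u - ⌊u⌋₊) ^ (-(1 / 2 : ℝ)) + (⌊u⌋₊ + 1 - u) ^ (-(1 / 2 : ℝ))) = 4 := by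
  have hr : (-1 : ℝ) < -(1 / 2) := by norm_num
  -- the two shifted powers
  have hI1 : IntervalIntegrable (fun u : ℝ ↦ (u - n) ^ (-(1 / 2 : ℝ))) volume n (n + 1) := by
    have h := (intervalIntegral.intervalIntegrable_rpow' (a := 0) (b := 1) hr).comp_sub_right (n : ℝ)
    rwa [zero_add, add_comm] at h
  have hI2 : IntervalIntegrable (fun u : ℝ ↦ ((n : ℝ) + 1 - u) ^ (-(1 / 2 : ℝ))) volume n (n + 1) := by
    have h := (intervalIntegral.intervalIntegrable_rpow' (a := 0) (b := 1) hr).comp_sub_left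
      ((n : ℝ) + 1)
    rw [sub_zero, add_sub_cancel_right] at h
    exact h.symm
  have hint1 : ∫ u in (n : ℝ)..(n + 1), (u - n) ^ (-(1 / 2 : ℝ)) = 2 := by
    rw [intervalIntegral.integral_comp_sub_right (fun x : ℝ ↦ x ^ (-(1 / 2 : ℝ))), sub_self,
      add_sub_cancel_left, integral_rpow (Or.inl hr)]
    norm_num
  have hint2 : ∫ u in (n : ℝ)..(n + 1), ((n : ℝ) + 1 - u) ^ (-(1 / 2 : ℝ)) = 2 := by
    rw [intervalIntegral.integral_comp_sub_left (fun x : ℝ ↦ x ^ (-(1 / 2 : ℝ))), sub_self,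
      add_sub_cancel_left, integral_rpow (Or.inl hr)]
    norm_num
  have hIg : IntervalIntegrable
      (fun u : ℝ ↦ (u - n) ^ (-(1 / 2 : ℝ)) + ((n : ℝ) + 1 - u) ^ (-(1 / 2 : ℝ))) volume n (n + 1) :=
    hI1.add hI2
  constructor
  · exact (intervalIntegrable_congr ((phi_eqOn n).symm.mono Set.uIoc_subset_uIcc)).1 hIg
  · rw [intervalIntegral.integral_congr (phi_eqOn n), intervalIntegral.integral_add hI1 hI2, hint1,
      hint2]
    norm_num

/-- `φ` is integrable on `[a, a + N]` with `∫_a^{a+N} φ = 4N` (`a, N ∈ ℕ`). [folklore] -/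
theorem integral_phi (a N : ℕ) :
    IntervalIntegrable
        (fun u : ℝ ↦ (u - ⌊u⌋₊) ^ (-(1 / 2 : ℝ)) + (⌊u⌋₊ + 1 - u) ^ (-(1 / 2 : ℝ))) volume a (a + N) ∧
      ∫ u in (a : ℝ)..(a + N), ((u - ⌊u⌋₊) ^ (-(1 / 2 : ℝ)) + (⌊u⌋₊ + 1 - u) ^ (-(1 / 2 : ℝ))) =
        4 * N := by
  set s : ℕ → ℝ := fun k ↦ ((a + k : ℕ) : ℝ) with hs
  have hs0 : s 0 = a := by simp [hs]
  have hsN : s N = a + N := by simp [hs]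
  have hstep : ∀ k, s (k + 1) = s k + 1 := by intro k; simp [hs]; ring
  have hk : ∀ k < N, IntervalIntegrable
      (fun u : ℝ ↦ (u - ⌊u⌋₊) ^ (-(1 / 2 : ℝ)) + (⌊u⌋₊ + 1 - u) ^ (-(1 / 2 : ℝ))) volume
        (s k) (s (k + 1)) := by
    intro k _
    rw [hstep]
    exact (integral_phi_unit (a + k)).1
  refine ⟨?_, ?_⟩
  · have h := IntervalIntegrable.trans_iterate hk
    rwa [hs0, hsN] at h
  · have h := intervalIntegral.sum_integral_adjacent_intervals hk
    rw [hs0, hsN] at h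
    rw [← h]
    have : ∀ k ∈ Finset.range N, ∫ u in s k..s (k + 1),
        ((u - ⌊u⌋₊) ^ (-(1 / 2 : ℝ)) + (⌊u⌋₊ + 1 - u) ^ (-(1 / 2 : ℝ))) = 4 := by
      intro k _
      rw [hstep]
      exact (integral_phi_unit (a + k)).2
    rw [Finset.sum_congr rfl this]
    simp [mul_comm]

/-! ### The integrated remainder -/

/-- **The remainder of the explicit formula, integrated against `|t| u⁻¹ du`.** Let
`2 ≤ c ≤ X`, `T ≥ 1`, `K ≥ 0`, `q ≥ 1`, and let `G : ℝ → ℂ` satisfy, for a.e. `u ∈ (c, X]`,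
`‖G(u)‖ ≤ |t| u⁻¹ K ((log u) min(1, u/(T⟨u⟩)) + (u/T) log²(quT))` (the shape of MV (12.8)). Then
`‖∫_c^X G(u) du‖ ≤ |t| K (4 X log X /(cT)^{1/2} + X log²(qXT)/T)`.
With `T = q x²(|t| + 2)²`, `X ≤ 2x`, this is `O(K log x + K log(qx(|t| + 2)))`.
[cite: MontgomeryVaughan2007, Theorem 12.10 (12.8)] -/
theorem norm_integral_remainder_le {c X T K q t : ℝ} (hc : 2 ≤ c) (hcX : c ≤ X) (hT : 1 ≤ T)
    (hK : 0 ≤ K) (hq : 1 ≤ q) {G : ℝ → ℂ}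
    (hG : ∀ᵐ u : ℝ, u ∈ Ioc c X → ‖G u‖ ≤ |t| * u⁻¹ *
      (K * (Real.log u * min 1 (u / (T * primePowDist u)) + u / T * Real.log (q * u * T) ^ 2))) :
    ‖∫ u in c..X, G u‖ ≤
      |t| * K * (4 * X * Real.log X / Real.sqrt (c * T) + X * Real.log (q * X * T) ^ 2 / T) := by
  have hT0 : 0 < T := by linarith
  have hc0 : 0 < c := by linarith
  have hX2 : 2 ≤ X := hc.trans hcX
  have hX0 : 0 < X := by linarith
  have hlogX : 0 ≤ Real.log X := Real.log_nonneg (by linarith)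
  have htK : 0 ≤ |t| * K := mul_nonneg (abs_nonneg t) hK
  set φ : ℝ → ℝ := fun u ↦ (u - ⌊u⌋₊) ^ (-(1 / 2 : ℝ)) + (⌊u⌋₊ + 1 - u) ^ (-(1 / 2 : ℝ)) with hφ
  have hφ0 : ∀ u, 0 ≤ u → 0 ≤ φ u := fun u hu ↦
    add_nonneg (Real.rpow_nonneg (sub_nonneg.2 (Nat.floor_le hu)) _)
      (Real.rpow_nonneg (by linarith [Nat.lt_floor_add_one u]) _)
  -- the two constants of the majorant `g = |t| K (A φ + B)`
  set A : ℝ := Real.log X / Real.sqrt (c * T) with hA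
  set B : ℝ := Real.log (q * X * T) ^ 2 / T with hB
  have hA0 : 0 ≤ A := by positivity
  have hB0 : 0 ≤ B := by positivity
  -- (1) the pointwise bound `‖G u‖ ≤ g u` a.e. on `(c, X]`
  have hbound : ∀ᵐ u : ℝ, u ∈ Ioc c X → ‖G u‖ ≤ |t| * K * (A * φ u + B) := by
    filter_upwards [hG] with u hu hmem
    obtain ⟨hcu, huX⟩ := hmem
    have hu0 : 0 < u := hc0.trans hcu
    have hu1 : 1 ≤ u := by linarith
    have hφu : 0 ≤ φ u := hφ0 u hu0.le
    set m : ℝ := min 1 (u / (T * primePowDist u)) with hm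
    have hm0 : 0 ≤ m := le_min zero_le_one (div_nonneg hu0.le (mul_nonneg hT0.le (primePowDist_nonneg u)))
    have hmin : m ≤ Real.sqrt (u / T) * φ u := min_one_div_le_sqrt_mul hu1 hT0
    have hlogu : Real.log u ≤ Real.log X := Real.log_le_log hu0 huX
    have hlogu0 : 0 ≤ Real.log u := Real.log_nonneg hu1
    -- `u⁻¹ (u/T)^{1/2} ≤ (cT)^{-1/2}`
    have hsq : u⁻¹ * Real.sqrt (u / T) ≤ 1 / Real.sqrt (c * T) := by
      rw [inv_mul_le_iff₀ hu0]
      have h1 : Real.sqrt (u / T) ≤ Real.sqrt (u ^ 2 / (c * T)) :=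
        Real.sqrt_le_sqrt (by
          rw [div_le_div_iff₀ hT0 (by positivity)]
          nlinarith [mul_nonneg (mul_nonneg hu0.le hT0.le) (sub_nonneg.2 hcu.le)])
      refine h1.trans (le_of_eq ?_)
      rw [Real.sqrt_div' _ (by positivity), Real.sqrt_sq hu0.le, mul_one_div]
    have h1 : u⁻¹ * m ≤ 1 / Real.sqrt (c * T) * φ u :=
      calc u⁻¹ * m ≤ u⁻¹ * (Real.sqrt (u / T) * φ u) :=
            mul_le_mul_of_nonneg_left hmin (inv_nonneg.2 hu0.le)
        _ = u⁻¹ * Real.sqrt (u / T) * φ u := by ring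
        _ ≤ 1 / Real.sqrt (c * T) * φ u := mul_le_mul_of_nonneg_right hsq hφu
    have h2 : Real.log u * (u⁻¹ * m) ≤ Real.log X * (1 / Real.sqrt (c * T) * φ u) :=
      mul_le_mul hlogu h1 (mul_nonneg (inv_nonneg.2 hu0.le) hm0) hlogX
    -- `log²(quT) ≤ log²(qXT)`
    have hquT : 1 ≤ q * u * T := by nlinarith [mul_nonneg (by linarith : (0 : ℝ) ≤ q - 1) hu0.le]
    have hLu0 : 0 ≤ Real.log (q * u * T) := Real.log_nonneg hquT
    have hLu : Real.log (q * u * T) ≤ Real.log (q * X * T) :=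
      Real.log_le_log (by positivity) (by nlinarith [mul_nonneg (by linarith : (0 : ℝ) ≤ q) hT0.le])
    have h3 : Real.log (q * u * T) ^ 2 / T ≤ B :=
      div_le_div_of_nonneg_right (pow_le_pow_left₀ hLu0 hLu 2) hT0.le
    have halg : |t| * u⁻¹ * (K * (Real.log u * m + u / T * Real.log (q * u * T) ^ 2)) =
        |t| * K * (Real.log u * (u⁻¹ * m) + Real.log (q * u * T) ^ 2 / T) := by
      field_simp
    refine (hu ⟨hcu, huX⟩).trans ?_
    rw [halg]
    refine mul_le_mul_of_nonneg_left ?_ htK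
    have h4 : Real.log X * (1 / Real.sqrt (c * T) * φ u) = A * φ u := by rw [hA]; ring
    linarith
  -- (2) integrability of the majorant on `[c, X] ⊆ [2, ⌊X⌋ + 1]`
  set N : ℕ := ⌊X⌋₊ - 1 with hN
  have hflX : 2 ≤ ⌊X⌋₊ := Nat.le_floor hX2
  have hXN : X ≤ (2 : ℝ) + N := by
    have h1 : X < (⌊X⌋₊ : ℝ) + 1 := Nat.lt_floor_add_one X
    have h2 : ((2 : ℕ) : ℝ) + (N : ℝ) = (⌊X⌋₊ : ℝ) + 1 := by
      rw [hN]; push_cast [Nat.cast_sub (by omega : 1 ≤ ⌊X⌋₊)]; ring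
    push_cast at h2
    linarith
  have hNX : (N : ℝ) ≤ X := by
    have h1 : (⌊X⌋₊ : ℝ) ≤ X := Nat.floor_le hX0.le
    have h2 : (N : ℝ) ≤ ⌊X⌋₊ := by exact_mod_cast Nat.sub_le _ _
    linarith
  obtain ⟨hφint, hφval⟩ := integral_phi 2 N
  push_cast at hφint hφval
  have hφintc : IntervalIntegrable φ volume c X := by
    refine hφint.mono_set ?_
    rw [uIcc_of_le hcX, uIcc_of_le (by linarith)]
    exact Icc_subset_Icc hc hXN
  have hgint : IntervalIntegrable (fun u ↦ |t| * K * (A * φ u + B)) volume c X :=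
    ((hφintc.const_mul A).add intervalIntegrable_const).const_mul (|t| * K)
  -- (3) the integral of the majorant
  have hφle : ∫ u in c..X, φ u ≤ 4 * X := by
    have hmono : ∫ u in c..X, φ u ≤ ∫ u in (2 : ℝ)..2 + N, φ u :=
      intervalIntegral.integral_mono_interval hc hcX hXN
        ((ae_restrict_mem measurableSet_Ioc).mono fun u hu ↦ hφ0 u (by linarith [hu.1])) hφint
    rw [hφval] at hmono
    linarith
  have hval : ∫ u in c..X, |t| * K * (A * φ u + B) = |t| * K * (A * (∫ u in c..X, φ u) + (X - c) * B) := by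
    rw [intervalIntegral.integral_const_mul, intervalIntegral.integral_add (hφintc.const_mul A)
      intervalIntegrable_const, intervalIntegral.integral_const_mul, intervalIntegral.integral_const,
      smul_eq_mul]
  calc ‖∫ u in c..X, G u‖ ≤ ∫ u in c..X, |t| * K * (A * φ u + B) :=
        intervalIntegral.norm_integral_le_of_norm_le hcX hbound hgint
    _ = |t| * K * (A * (∫ u in c..X, φ u) + (X - c) * B) := hval
    _ ≤ |t| * K * (A * (4 * X) + X * B) := by
        refine mul_le_mul_of_nonneg_left (add_le_add (mul_le_mul_of_nonneg_left hφle hA0) ?_) htK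
        exact mul_le_mul_of_nonneg_right (by linarith) hB0
    _ = |t| * K * (4 * X * Real.log X / Real.sqrt (c * T) + X * Real.log (q * X * T) ^ 2 / T) := by
        rw [hA, hB]; ring

end GRHTwistedPrimeSum

end Literature.NumberTheory.LFunctions
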